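import Literature.RingTheory.FormalGroups.DworkFrobeniusLift
import Mathlib.RingTheory.PowerSeries.Exp
import Mathlib.RingTheory.PowerSeries.Derivative
import Mathlib.NumberTheory.Padics.PadicVal.Basic
import HarnessLib

/-!
# Hazewinkel's functional equation lemma in exponential form (Blakestad–Grant 2023, Cor. 6)

Topic `RingTheory/FormalGroups` (proofs only; no definitions, no named facts). Sequel of
`DworkFrobeniusLift.lean` (setting and sources there): from Dwork's lemma with a Frobenius
endomorphism `α` and a Frobenius lift `t'` we derive Blakestad–Grant's Cor. 6 (a)(b)(c)
(J. Number Theory 249 (2023), §2.2) — the form of Hazewinkel's functional equation lemma applied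
in the proof of their Thm. 1 (integrality of the universal `p`-adic sigma function
`σ = t·exp(∫ ζ̃ ω)`, via `g(t) - p⁻¹α(g)(t') = log(u(t))/p ∈ R̂⟦t⟧`, Prop. 13(b)). Here `K` is a
commutative `ℚ`-algebra, `A ≤ K` a subring with `ℤ_(p) ⊆ A` (`1/m ∈ A` for `p ∤ m`) and
`K = A[1/p]`, `α : K → K` a ring endomorphism with `α(A) ⊆ A`, `α(r) - rᵖ ∈ pA` on `A`.

* `exp_subst_add`, `exp_subst_nsmul`, `map_exp_subst`, `exp_subst_subst`, `coeff_one_exp_subst` —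
  `exp(f + g) = exp(f)exp(g)` for series without constant term (uniqueness principle
  `PowerSeries.derivative.ext`) and its consequences;
* `exists_coeff_exp_subst_mul_eq` — `exp(pw) ∈ 1 + pXA⟦X⟧` for `w ∈ XA⟦X⟧` (`v_p(d!) < d`,
  Mathlib `padicValNat_factorial_lt_of_ne_zero`; this is where `ℤ_(p) ⊆ A` enters);
* `coeff_exp_subst_mem_of_sub_subst`, `coeff_exp_subst_mem_of_functionalEquation_subst` —
  **Cor. 6(c)**: for `t' ∈ tA⟦t⟧` with `t' ≡ tᵖ (mod p)` and `a ∈ tK⟦t⟧` with `[t¹]a ∈ A`, if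
  `a(t) - p⁻¹α(a)(t')` has coefficients in `A` then so does `exp(a(t))`. Proof: with
  `pa - α(a)(t') = pw`, `(α_* exp a)(t') = (exp a)ᵖ · exp(-pw)`, and Dwork's lemma applies.
  (Blakestad–Grant assume `da/dt ∈ A⟦t⟧`, i.e. `a = ∑ c_{n-1}tⁿ/n` with all `cₙ ∈ A`; only
  `c₀ = [t¹]a ∈ A` is used, so the statement here is slightly more general.)
* `coeff_exp_subst_mem_of_functionalEquation` — **Cor. 6(a)**: the case `t' = tᵖ`, where
  `[t¹]a ∈ A` is automatic;
* `coeff_sub_expand_mem_iff` — **Cor. 6(b)**: for `a = ∑_{n ≥ 1} c_{n-1}tⁿ/n` with `cₙ ∈ A`,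
  `a - p⁻¹α(a)(tᵖ) ∈ A⟦t⟧` iff `c_{np-1} - α(c_{n-1}) ∈ pnA` for all `n ≥ 1`.

## Sources

* C. Blakestad, D. Grant, J. Number Theory 249 (2023) (arXiv:1903.02480), §2.2: Cor. 6 (a)(b)(c)
  and proofs ("(a) … since `α` is trivial on the prime subfield `ℚ` of `K`, and
  `log(1+t) - p⁻¹log(1+tᵖ)` is in `R̂⟦t⟧`"; "(b) … comparing coefficients of `t^{np}`";
  "(c) … if `t' ≡ tᵖ (mod p)` then `(t')ⁿ ≡ t^{pn} (mod pn)`"), Prop. 13(b), proof of Thm. 1.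
  [BlakestadGrant2023]
* N. Koblitz, GTM 58 (1984), Ch. IV §2, Lemma 3 (Dwork's lemma). [Koblitz1984]

## Design notes

* Blakestad–Grant derive (a) from Lemma 5 (`b⁻¹(a(t)) ∈ R̂⟦t⟧`, `b = log(1 + t)`) and (c) from
  (a), (b). Here (c) ⊇ (a) come straight from the multiplicative Dwork lemma of
  `DworkFrobeniusLift.lean`; Lemma 5 for a general `b` is not needed for Thm. 1 and is not
  vendored. The hypothesis "`a - p⁻¹α(a)(t')` has coefficients in `A`" is used in the equivalent
  form `pa - α(a)(t') ∈ pA⟦t⟧` (`exists_coeff_sub_eq_mul_of_coeff_sub_smul_mem`).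
* Pure proof file; nothing is asserted.
-/

noncomputable section

open PowerSeries

namespace Literature.RingTheory.FormalGroups

variable {K : Type*} [CommRing K]

/-! ### Exponentials of series without constant term -/

section Exp

variable [Algebra ℚ K]

/-- `exp(f)(0) = 1` for `f(0) = 0`. [folklore] -/
theorem constantCoeff_exp_subst {f : K⟦X⟧} (hf : constantCoeff f = 0) :
    constantCoeff ((exp K).subst f) = 1 := by
  rw [constantCoeff_subst_of_constantCoeff_eq_zero hf, constantCoeff_exp]

/-- `[X¹] exp(f) = [X¹] f` for `f(0) = 0`. [folklore] -/
theorem coeff_one_exp_subst {f : K⟦X⟧} (hf : constantCoeff f = 0) :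
    coeff 1 ((exp K).subst f) = coeff 1 f := by
  rw [coeff_subst' (HasSubst.of_constantCoeff_zero' hf), finsum_eq_single _ 1]
  · rw [pow_one, coeff_exp, Nat.factorial_one, Nat.cast_one, div_one, map_one, one_smul]
  · intro d hd
    rcases Nat.lt_or_gt_of_ne hd with h | h
    · rw [Nat.lt_one_iff.mp h, pow_zero, coeff_one, if_neg one_ne_zero, smul_zero]
    · have h0 : coeff 1 (f ^ d) = 0 := by
        refine coeff_of_lt_order 1 (lt_of_lt_of_le (show ((1 : ℕ) : ℕ∞) < (d : ℕ∞) by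
          exact_mod_cast h) ?_)
        refine le_trans ?_ (le_order_pow f d)
        have h1 : (1 : ℕ∞) ≤ f.order := (one_le_order_iff_constCoeff_eq_zero).mpr hf
        calc (d : ℕ∞) = d • (1 : ℕ∞) := by simp
          _ ≤ d • f.order := nsmul_le_nsmul_right h1 d
      rw [h0, smul_zero]

/-- Chain rule: `(exp f)' = exp(f) · f'`. [folklore] -/
theorem derivative_exp_subst {f : K⟦X⟧} (hf : constantCoeff f = 0) :
    d⁄dX K ((exp K).subst f) = (exp K).subst f * d⁄dX K f := by
  rw [derivative_subst K (HasSubst.of_constantCoeff_zero' hf), derivative_exp]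

/-- `exp(0) = 1`. [folklore] -/
theorem exp_subst_zero : (exp K).subst (0 : K⟦X⟧) = 1 := by
  rw [subst_zero_eq_C_constantCoeff, constantCoeff_exp, map_one, map_one]

/-- **`exp(f + g) = exp(f) exp(g)`** for `f(0) = g(0) = 0` (both sides of
`exp(f+g)exp(-f)exp(-g) = 1` have zero derivative and constant term `1`). [folklore] -/
theorem exp_subst_add {f g : K⟦X⟧} (hf : constantCoeff f = 0) (hg : constantCoeff g = 0) :
    (exp K).subst (f + g) = (exp K).subst f * (exp K).subst g := by
  haveI := IsAddTorsionFree.of_module_rat (M := K)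
  have hneg : ∀ {h : K⟦X⟧}, constantCoeff h = 0 → (exp K).subst h * (exp K).subst (-h) = 1 := by
    intro h hh
    have hh' : constantCoeff (-h) = 0 := by rw [map_neg, hh, neg_zero]
    refine derivative.ext ?_ ?_
    · rw [Derivation.leibniz, derivative_exp_subst hh, derivative_exp_subst hh', map_neg,
        Derivation.map_one_eq_zero, smul_eq_mul, smul_eq_mul]
      ring
    · rw [map_mul, constantCoeff_exp_subst hh, constantCoeff_exp_subst hh', map_one, mul_one]
  have hfg : constantCoeff (f + g) = 0 := by rw [map_add, hf, hg, add_zero]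
  have hf' : constantCoeff (-f) = 0 := by rw [map_neg, hf, neg_zero]
  have hg' : constantCoeff (-g) = 0 := by rw [map_neg, hg, neg_zero]
  have hQ : (exp K).subst (f + g) * ((exp K).subst (-f) * (exp K).subst (-g)) = 1 := by
    refine derivative.ext ?_ ?_
    · simp only [Derivation.leibniz, derivative_exp_subst hfg, derivative_exp_subst hf',
        derivative_exp_subst hg', map_neg, map_add, Derivation.map_one_eq_zero, smul_eq_mul]
      ring
    · simp only [map_mul, constantCoeff_exp_subst hfg, constantCoeff_exp_subst hf',
        constantCoeff_exp_subst hg', map_one, mul_one]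
  calc (exp K).subst (f + g)
      = (exp K).subst (f + g) * (((exp K).subst f * (exp K).subst (-f)) *
          ((exp K).subst g * (exp K).subst (-g))) := by rw [hneg hf, hneg hg, mul_one, mul_one]
    _ = (exp K).subst (f + g) * ((exp K).subst (-f) * (exp K).subst (-g)) *
          ((exp K).subst f * (exp K).subst g) := by ring
    _ = (exp K).subst f * (exp K).subst g := by rw [hQ, one_mul]

/-- `exp(f) exp(-f) = 1`. [folklore] -/
theorem exp_subst_mul_exp_subst_neg {f : K⟦X⟧} (hf : constantCoeff f = 0) :
    (exp K).subst f * (exp K).subst (-f) = 1 := by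
  rw [← exp_subst_add hf (by rw [map_neg, hf, neg_zero]), add_neg_cancel, exp_subst_zero]

/-- `exp(n f) = exp(f)ⁿ`. [folklore] -/
theorem exp_subst_nsmul {f : K⟦X⟧} (hf : constantCoeff f = 0) (n : ℕ) :
    (exp K).subst (n • f) = ((exp K).subst f) ^ n := by
  induction n with
  | zero => rw [zero_smul, pow_zero, exp_subst_zero]
  | succ n ih =>
    rw [succ_nsmul, exp_subst_add _ hf, ih, pow_succ]
    rw [map_nsmul, hf, smul_zero]

/-- `exp` commutes with ring homomorphisms: `h_*(exp f) = exp(h_* f)`. [folklore] -/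
theorem map_exp_subst {L : Type*} [CommRing L] [Algebra ℚ L] (h : K →+* L) {f : K⟦X⟧}
    (hf : constantCoeff f = 0) : PowerSeries.map h ((exp K).subst f) = (exp L).subst (f.map h) := by
  rw [map_subst_apply (HasSubst.of_constantCoeff_zero' hf), map_exp]

/-- `exp(f)(g) = exp(f(g))`. [folklore] -/
theorem exp_subst_subst {f g : K⟦X⟧} (hf : constantCoeff f = 0) (hg : constantCoeff g = 0) :
    PowerSeries.subst g ((exp K).subst f) = (exp K).subst (f.subst g) :=
  subst_comp_subst_apply (HasSubst.of_constantCoeff_zero' hf) (HasSubst.of_constantCoeff_zero' hg) _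

end Exp

/-! ### `exp(p w) ∈ 1 + pXA⟦X⟧` for `w ∈ XA⟦X⟧` when `ℤ_(p) ⊆ A` -/

section ExpP

variable [Algebra ℚ K] (p : ℕ) [hp : Fact p.Prime] (A : Subring K)

/-- **`pᵈ/d! ∈ pℤ_(p)` for `d ≥ 1`** (`v_p(d!) < d`), read in a `ℚ`-algebra `K` with a subring
`A ⊇ ℤ_(p)`: `pᵈ · (1/d!) = p · c` with `c ∈ A`. [folklore] -/
theorem exists_pow_mul_inv_factorial_eq (hA : ∀ m : ℕ, ¬ p ∣ m → algebraMap ℚ K (1 / m) ∈ A)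
    {d : ℕ} (hd : d ≠ 0) :
    ∃ c ∈ A, (p : K) ^ d * algebraMap ℚ K (1 / (d.factorial : ℕ)) = p * c := by
  set v := (d.factorial).factorization p with hv
  set m := d.factorial / p ^ v with hm
  have hfac : p ^ v * m = d.factorial := Nat.ordProj_mul_ordCompl_eq_self _ _
  have hcop : p.Coprime m := Nat.coprime_ordCompl hp.out (Nat.factorial_ne_zero d)
  have hvd : v < d := by
    rw [hv, Nat.factorization_def _ hp.out]
    exact padicValNat_factorial_lt_of_ne_zero p hd
  have hpm : ¬ p ∣ m := fun h => hp.out.one_lt.ne' ((Nat.coprime_self p).mp <|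
    (Nat.Coprime.of_dvd_right h hcop : p.Coprime p))
  have hm0 : (m : ℚ) ≠ 0 := by
    have : m ≠ 0 := fun h => by
      rw [h, mul_zero] at hfac
      exact Nat.factorial_ne_zero d hfac.symm
    exact_mod_cast this
  refine ⟨(p : K) ^ (d - v - 1) * algebraMap ℚ K (1 / m), mul_mem (pow_mem (natCast_mem A p) _)
    (hA m hpm), ?_⟩
  obtain ⟨e, he⟩ : ∃ e, d = v + 1 + e := ⟨d - v - 1, by omega⟩
  have hq : ((p : ℚ) ^ d * (1 / (d.factorial : ℕ)) : ℚ) =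
      p * ((p : ℚ) ^ (d - v - 1) * (1 / m)) := by
    rw [← hfac, show d - v - 1 = e by omega, he]
    have hp0 : (p : ℚ) ≠ 0 := by exact_mod_cast hp.out.ne_zero
    push_cast
    field_simp
    ring
  have := congrArg (algebraMap ℚ K) hq
  simpa only [map_mul, map_pow, map_natCast] using this

/-- **`exp(p w) ∈ 1 + pXA⟦X⟧`** for `w ∈ XA⟦X⟧`, `A ⊇ ℤ_(p)`: the coefficient of `Xⁿ`, `n ≥ 1`,
is `∑_{1 ≤ d ≤ n} (pᵈ/d!) [Xⁿ] wᵈ ∈ pA`. [folklore] -/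
theorem exists_coeff_exp_subst_mul_eq (hA : ∀ m : ℕ, ¬ p ∣ m → algebraMap ℚ K (1 / m) ∈ A)
    {w : K⟦X⟧} (hw0 : constantCoeff w = 0) (hw : ∀ n, coeff n w ∈ A) (n : ℕ) :
    ∃ a ∈ A, coeff (n + 1) ((exp K).subst ((p : K) • w)) = p * a := by
  obtain ⟨W, hW⟩ := exists_map_subtype_eq_of_coeff_mem A hw
  have hpw0 : constantCoeff ((p : K) • w) = 0 := by
    rw [smul_eq_C_mul, map_mul, hw0, mul_zero]
  -- the finite sum formula
  have hsum : coeff (n + 1) ((exp K).subst ((p : K) • w)) = (Finset.range (n + 2)).sum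
      fun d => algebraMap ℚ K (1 / (d.factorial : ℕ)) * ((p : K) ^ d * coeff (n + 1) (w ^ d)) := by
    rw [coeff_subst' (HasSubst.of_constantCoeff_zero' hpw0),
      finsum_eq_sum_of_support_subset _ (s := Finset.range (n + 2))]
    · refine Finset.sum_congr rfl fun d _ => ?_
      rw [coeff_exp, smul_pow, coeff_smul, smul_eq_mul, smul_eq_mul]
    · intro d hd
      rw [Function.mem_support] at hd
      rw [Finset.coe_range, Set.mem_Iio]
      by_contra h
      apply hd
      have h0 : coeff (n + 1) (((p : K) • w) ^ d) = 0 := by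
        refine coeff_of_lt_order _ (lt_of_lt_of_le (show ((n + 1 : ℕ) : ℕ∞) < (d : ℕ∞) by
          exact_mod_cast Nat.lt_of_succ_le (not_lt.mp h)) (le_trans ?_ (le_order_pow _ d)))
        have h1 : (1 : ℕ∞) ≤ ((p : K) • w).order := (one_le_order_iff_constCoeff_eq_zero).mpr hpw0
        calc (d : ℕ∞) = d • (1 : ℕ∞) := by simp
          _ ≤ d • ((p : K) • w).order := nsmul_le_nsmul_right h1 d
      rw [h0, smul_zero]
  -- each term is `p ·` an element of `A`
  have hterm : ∀ d ∈ Finset.range (n + 2), ∃ a ∈ A,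
      algebraMap ℚ K (1 / (d.factorial : ℕ)) * ((p : K) ^ d * coeff (n + 1) (w ^ d)) = p * a := by
    intro d _
    rcases Nat.eq_zero_or_pos d with rfl | hd
    · exact ⟨0, zero_mem A, by rw [pow_zero, pow_zero, coeff_one, if_neg (Nat.succ_ne_zero n),
        mul_zero, mul_zero, mul_zero]⟩
    · obtain ⟨c, hc, h⟩ := exists_pow_mul_inv_factorial_eq p A hA hd.ne'
      refine ⟨c * coeff (n + 1) (w ^ d), mul_mem hc ?_, ?_⟩
      · rw [← hW, ← map_pow]; exact coeff_map_subtype_mem A _ _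
      · rw [← mul_assoc, mul_comm (algebraMap ℚ K _), h, mul_assoc]
  rw [hsum]
  -- sum up
  have key : ∀ t : Finset ℕ, (∀ d ∈ t, ∃ a ∈ A,
      algebraMap ℚ K (1 / (d.factorial : ℕ)) * ((p : K) ^ d * coeff (n + 1) (w ^ d)) = p * a) →
      ∃ a ∈ A, (t.sum fun d => algebraMap ℚ K (1 / (d.factorial : ℕ)) *
        ((p : K) ^ d * coeff (n + 1) (w ^ d))) = p * a := by
    intro t
    induction t using Finset.induction_on with
    | empty => exact fun _ => ⟨0, zero_mem A, by rw [Finset.sum_empty, mul_zero]⟩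
    | insert d t hdt ih =>
      intro ht
      obtain ⟨a, ha, h⟩ := ih (fun d' hd' => ht d' (Finset.mem_insert_of_mem hd'))
      obtain ⟨b, hb, h'⟩ := ht d (Finset.mem_insert_self d t)
      exact ⟨b + a, add_mem hb ha, by rw [Finset.sum_insert hdt, h, h', mul_add]⟩
  exact key _ hterm

end ExpP

/-! ### Hazewinkel's functional equation lemma, exponential form (Blakestad–Grant 2023, Cor. 6) -/

section FunctionalEquation

variable [Algebra ℚ K] (p : ℕ) [hp : Fact p.Prime] (A : Subring K) (α : K →+* K)

/-- `p` is a unit in a `ℚ`-algebra. [folklore] -/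
theorem isUnit_natCast_prime : IsUnit ((p : ℕ) : K) := by
  have : ((p : ℕ) : K) = algebraMap ℚ K p := by rw [map_natCast]
  rw [this]
  exact (IsUnit.mk0 (p : ℚ) (by exact_mod_cast hp.out.ne_zero)).map _

/-- **Blakestad–Grant 2023, Cor. 6(c) (Hazewinkel's functional equation lemma, exponential form,
with a Frobenius lift `t'`), core version.** Let `A ⊆ K` (`K` a `ℚ`-algebra) be a subring with
`ℤ_(p) ⊆ A`, `K = A[1/p]`, `α : K → K` a ring endomorphism with `α(A) ⊆ A`, `α(r) ≡ rᵖ (mod pA)`,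
and `t' ∈ A⟦X⟧` with `t' ≡ Xᵖ (mod p)`, `t'(0) = 0`. If `a ∈ XK⟦X⟧` has `[X¹]a ∈ A` and
`p·a - (α_* a)(t') ∈ pA⟦X⟧` (i.e. `a - p⁻¹ α(a)(t') ∈ A⟦X⟧`), then `exp(a) ∈ A⟦X⟧`. Proof:
with `p a - α(a)(t') = p w`, `exp(a)ᵖ · exp(-p w) = (α_* exp a)(t')` and `exp(-pw) ∈ 1 + pXA⟦X⟧`,
so Dwork's lemma `coeff_mem_of_map_subst_eq_pow_mul` applies. (Blakestad–Grant assume all of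
`da/dt ∈ A⟦X⟧`; only `[X¹]a ∈ A` is used.) [cite: BlakestadGrant2023, Cor. 6(c)] -/
theorem coeff_exp_subst_mem_of_sub_subst
    (hA : ∀ m : ℕ, ¬ p ∣ m → algebraMap ℚ K (1 / m) ∈ A)
    (hK : ∀ x : K, ∃ k : ℕ, (p : K) ^ k * x ∈ A)
    (hαA : ∀ r ∈ A, α r ∈ A) (hα : ∀ r ∈ A, ∃ a ∈ A, α r = r ^ p + p * a)
    {t' : K⟦X⟧} (ht'0 : constantCoeff t' = 0)
    (ht' : ∀ n, ∃ b ∈ A, coeff n t' = (if n = p then 1 else 0) + p * b)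
    {a : K⟦X⟧} (ha0 : constantCoeff a = 0) (ha1 : coeff 1 a ∈ A)
    (hfe : ∀ n, ∃ b ∈ A, coeff n ((p : K) • a - (a.map α).subst t') = p * b) :
    ∀ n, coeff n ((exp K).subst a) ∈ A := by
  have hpK : IsUnit ((p : ℕ) : K) := isUnit_natCast_prime p
  have ht's : HasSubst t' := HasSubst.of_constantCoeff_zero' ht'0
  -- `p a - α(a)(t') = p w`, `w ∈ XA⟦X⟧`
  choose b hb using hfe
  set w : K⟦X⟧ := PowerSeries.mk b with hwdef
  have hwA : ∀ n, coeff n w ∈ A := fun n => by rw [hwdef, coeff_mk]; exact (hb n).1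
  have hαa0 : constantCoeff ((a.map α).subst t') = 0 := by
    rw [constantCoeff_subst_of_constantCoeff_eq_zero ht'0, ← coeff_zero_eq_constantCoeff_apply,
      coeff_map, coeff_zero_eq_constantCoeff_apply, ha0, map_zero]
  have hw : (p : K) • a - (a.map α).subst t' = (p : K) • w := by
    ext n
    rw [(hb n).2, coeff_smul, hwdef, coeff_mk, smul_eq_mul]
  have hw0 : constantCoeff w = 0 := by
    have h0 := (hb 0).2
    rw [coeff_zero_eq_constantCoeff, map_sub, hαa0, sub_zero, smul_eq_C_mul, map_mul, ha0,
      mul_zero] at h0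
    have : constantCoeff w = b 0 := by rw [← coeff_zero_eq_constantCoeff_apply, hwdef, coeff_mk]
    rw [this]
    exact (hpK.mul_right_eq_zero.mp h0.symm)
  have hnw0 : constantCoeff (-w) = 0 := by rw [map_neg, hw0, neg_zero]
  have hpw0 : constantCoeff ((p : K) • (-w)) = 0 := by rw [smul_eq_C_mul, map_mul, hnw0, mul_zero]
  -- the relation `(α_* exp a)(t') = exp(a)ᵖ · exp(-p w)`
  set s : K⟦X⟧ := (exp K).subst a with hsdef
  set u : K⟦X⟧ := (exp K).subst ((p : K) • (-w)) with hudef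
  have heq : (s.map α).subst t' = s ^ p * u := by
    have h1 : (s.map α).subst t' = (exp K).subst ((a.map α).subst t') := by
      rw [hsdef, map_exp_subst α ha0, exp_subst_subst _ ht'0]
      rw [← coeff_zero_eq_constantCoeff_apply, coeff_map, coeff_zero_eq_constantCoeff_apply, ha0,
        map_zero]
    have h2 : s ^ p = (exp K).subst ((a.map α).subst t') * (exp K).subst ((p : K) • w) := by
      rw [hsdef, ← exp_subst_nsmul ha0, ← exp_subst_add hαa0 (by
        rw [smul_eq_C_mul, map_mul, hw0, mul_zero]), ← hw, add_sub_cancel, Nat.cast_smul_eq_nsmul]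
    rw [h1, h2, mul_assoc, hudef, smul_neg, exp_subst_mul_exp_subst_neg (by
      rw [smul_eq_C_mul, map_mul, hw0, mul_zero]), mul_one]
  refine coeff_mem_of_map_subst_eq_pow_mul p A α hpK hK hαA hα ht'0 ht' ?_ ?_ ?_ ?_ heq
  · rw [hsdef, constantCoeff_exp_subst ha0]
  · rwa [hsdef, coeff_one_exp_subst ha0]
  · rw [hudef, constantCoeff_exp_subst hpw0]
  · intro n
    exact exists_coeff_exp_subst_mul_eq p A hA hnw0 (fun n => neg_mem (hwA n)) n

/-- From the `p⁻¹`-form to the `p`-form of the functional equation hypothesis: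
`[Xⁿ](a - p⁻¹ G) ∈ A` gives `[Xⁿ](p a - G) = p · [Xⁿ](a - p⁻¹G) ∈ pA`. [folklore] -/
theorem exists_coeff_sub_eq_mul_of_coeff_sub_smul_mem {a G : K⟦X⟧}
    (h : ∀ n, coeff n (a - (p : ℚ)⁻¹ • G) ∈ A) (n : ℕ) :
    ∃ b ∈ A, coeff n ((p : K) • a - G) = p * b := by
  refine ⟨_, h n, ?_⟩
  have hpq : (p : K) • ((p : ℚ)⁻¹ • G) = G := by
    rw [Nat.cast_smul_eq_nsmul, ← Nat.cast_smul_eq_nsmul ℚ, smul_smul,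
      mul_inv_cancel₀ (by exact_mod_cast hp.out.ne_zero : (p : ℚ) ≠ 0), one_smul]
  conv_lhs => rw [← hpq, ← smul_sub, coeff_smul, smul_eq_mul]

/-- **Blakestad–Grant 2023, Cor. 6(c)** (Hazewinkel's functional equation lemma in exponential
form, with a Frobenius lift). `K` a commutative `ℚ`-algebra, `A ⊆ K` a subring with `ℤ_(p) ⊆ A`
and `K = A[1/p]`, `α` a ring endomorphism of `K` with `α(A) ⊆ A`, `α(r) ≡ rᵖ (mod p)` on `A`
(BG: `R̂`, its fraction field restricted to `R̂ ⊗ ℚ`, and `α`); `t' ∈ tA⟦t⟧` with `t' ≡ tᵖ (mod p)`.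
If `a ∈ tK⟦t⟧` with `[t¹]a ∈ A` (BG assume `da/dt ∈ A⟦t⟧`, i.e. `a = ∑ c_{n-1}tⁿ/n`, `cₙ ∈ A`;
only `c₀ ∈ A` is needed) and `a(t) - p⁻¹ α(a)(t')` has coefficients in `A`, then `exp(a(t))` has
coefficients in `A`. [cite: BlakestadGrant2023, Cor. 6(c)] -/
theorem coeff_exp_subst_mem_of_functionalEquation_subst
    (hA : ∀ m : ℕ, ¬ p ∣ m → algebraMap ℚ K (1 / m) ∈ A)
    (hK : ∀ x : K, ∃ k : ℕ, (p : K) ^ k * x ∈ A)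
    (hαA : ∀ r ∈ A, α r ∈ A) (hα : ∀ r ∈ A, ∃ a ∈ A, α r = r ^ p + p * a)
    {t' : K⟦X⟧} (ht'0 : constantCoeff t' = 0)
    (ht' : ∀ n, ∃ b ∈ A, coeff n t' = (if n = p then 1 else 0) + p * b)
    {a : K⟦X⟧} (ha0 : constantCoeff a = 0) (ha1 : coeff 1 a ∈ A)
    (hfe : ∀ n, coeff n (a - (p : ℚ)⁻¹ • (a.map α).subst t') ∈ A) :
    ∀ n, coeff n ((exp K).subst a) ∈ A :=
  coeff_exp_subst_mem_of_sub_subst p A α hA hK hαA hα ht'0 ht' ha0 ha1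
    (exists_coeff_sub_eq_mul_of_coeff_sub_smul_mem p A hfe)

/-- **Blakestad–Grant 2023, Cor. 6(a)** (Hazewinkel's functional equation lemma, exponential
form). With `K ⊇ A ⊇ ℤ_(p)`, `K = A[1/p]` and `α` as in
`coeff_exp_subst_mem_of_functionalEquation_subst`: for any `a ∈ tK⟦t⟧` such that
`a(t) - p⁻¹ α(a)(tᵖ)` has coefficients in `A`, `exp(a(t))` has coefficients in `A`. (BG derive
it from the functional equation lemma proper, `b⁻¹(a(t)) ∈ A⟦t⟧` with `b = log(1 + t)`; here it
is the case `t' = tᵖ` of (c), the hypothesis `[t¹]a ∈ A` being read off from the coefficient of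
`t¹`.) [cite: BlakestadGrant2023, Cor. 6(a)] -/
theorem coeff_exp_subst_mem_of_functionalEquation
    (hA : ∀ m : ℕ, ¬ p ∣ m → algebraMap ℚ K (1 / m) ∈ A)
    (hK : ∀ x : K, ∃ k : ℕ, (p : K) ^ k * x ∈ A)
    (hαA : ∀ r ∈ A, α r ∈ A) (hα : ∀ r ∈ A, ∃ a ∈ A, α r = r ^ p + p * a)
    {a : K⟦X⟧} (ha0 : constantCoeff a = 0)
    (hfe : ∀ n, coeff n (a - (p : ℚ)⁻¹ • expand p hp.out.ne_zero (a.map α)) ∈ A) :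
    ∀ n, coeff n ((exp K).subst a) ∈ A := by
  have hp1 : p ≠ 1 := hp.out.one_lt.ne'
  have hX0 : constantCoeff ((X : K⟦X⟧) ^ p) = 0 := by
    rw [map_pow, constantCoeff_X, zero_pow hp.out.ne_zero]
  have hX : ∀ n, ∃ b ∈ A, coeff n ((X : K⟦X⟧) ^ p) = (if n = p then 1 else 0) + p * b :=
    fun n => ⟨0, zero_mem A, by rw [coeff_X_pow, mul_zero, add_zero]⟩
  have hfe' : ∀ n, coeff n (a - (p : ℚ)⁻¹ • (a.map α).subst ((X : K⟦X⟧) ^ p)) ∈ A := by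
    intro n; rw [← expand_apply]; exact hfe n
  have ha1 : coeff 1 a ∈ A := by
    have h := hfe 1
    rwa [map_sub, coeff_smul, coeff_expand_of_not_dvd p hp.out.ne_zero _
      (fun h => hp1 (Nat.dvd_one.mp h)), smul_zero, sub_zero] at h
  exact coeff_exp_subst_mem_of_functionalEquation_subst p A α hA hK hαA hα hX0 hX ha0 ha1 hfe'

/-- **Blakestad–Grant 2023, Cor. 6(b)** (the functional equation as congruences on the
coefficients of `da/dt`). With `A ⊇ ℤ_(p)`: if `a = ∑_{n ≥ 1} (c_{n-1}/n) tⁿ` with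
`cₙ ∈ A`, then `a(t) - p⁻¹ α(a)(tᵖ)` has coefficients in `A` if and only if
`c_{np-1} ≡ α(c_{n-1}) (mod pn A)` for all `n ≥ 1` (here indexed by `n + 1`). Proof: compare
coefficients of `t^{np}`; the other coefficients `c_{m-1}/m`, `p ∤ m`, lie in `A` because
`1/m ∈ ℤ_(p) ⊆ A`. [cite: BlakestadGrant2023, Cor. 6(b)] -/
theorem coeff_sub_expand_mem_iff
    (hA : ∀ m : ℕ, ¬ p ∣ m → algebraMap ℚ K (1 / m) ∈ A)
    {c : ℕ → K} (hc : ∀ n, c n ∈ A) {a : K⟦X⟧} (ha0 : constantCoeff a = 0)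
    (ha : ∀ n, coeff (n + 1) a = algebraMap ℚ K (1 / (n + 1 : ℕ)) * c n) :
    (∀ m, coeff m (a - (p : ℚ)⁻¹ • expand p hp.out.ne_zero (a.map α)) ∈ A) ↔
      ∀ n, ∃ b ∈ A, c ((n + 1) * p - 1) - α (c n) = ((n + 1) * p : ℕ) * b := by
  have hp0 : p ≠ 0 := hp.out.ne_zero
  have hppos : 0 < p := hp.out.pos
  -- the coefficient of `t^{(n+1)p}`
  have hkey : ∀ n, coeff ((n + 1) * p) (a - (p : ℚ)⁻¹ • expand p hp0 (a.map α)) =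
      algebraMap ℚ K (1 / ((n + 1) * p : ℕ)) * (c ((n + 1) * p - 1) - α (c n)) := by
    intro n
    have hm : (n + 1) * p = ((n + 1) * p - 1) + 1 := (Nat.sub_add_cancel (Nat.mul_pos
      (Nat.succ_pos n) hppos)).symm
    rw [map_sub, coeff_smul, coeff_expand p hp0, if_pos ⟨n + 1, mul_comm _ _⟩,
      Nat.mul_div_cancel _ hppos, coeff_map, ha, map_mul, RingHom.map_rat_algebraMap]
    conv_lhs => rw [hm, ha, ← hm]
    have hq2 : (p : ℚ)⁻¹ * (1 / ((n + 1 : ℕ) : ℚ)) = 1 / (((n + 1) * p : ℕ) : ℚ) := by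
      rw [Nat.cast_mul, one_div, one_div, mul_inv, mul_comm]
    rw [Algebra.smul_def, ← mul_assoc, ← map_mul, hq2, mul_sub]
  constructor
  · intro h n
    refine ⟨_, h ((n + 1) * p), ?_⟩
    rw [hkey, ← mul_assoc, ← map_natCast (algebraMap ℚ K), ← map_mul, one_div,
      mul_inv_cancel₀ (by exact_mod_cast (Nat.mul_pos (Nat.succ_pos n) hppos).ne' :
        (((n + 1) * p : ℕ) : ℚ) ≠ 0), map_one, one_mul]
  · intro h m
    rcases Nat.eq_zero_or_pos m with rfl | hm
    · rw [map_sub, coeff_smul, coeff_zero_eq_constantCoeff_apply, ha0,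
        coeff_zero_eq_constantCoeff_apply, constantCoeff_expand,
        ← coeff_zero_eq_constantCoeff_apply, coeff_map, coeff_zero_eq_constantCoeff_apply, ha0,
        map_zero, smul_zero, sub_zero]
      exact zero_mem A
    by_cases hpm : p ∣ m
    · obtain ⟨j, rfl⟩ := hpm
      obtain ⟨n, rfl⟩ : ∃ n, j = n + 1 := ⟨j - 1, by
        rcases Nat.eq_zero_or_pos j with rfl | hj
        · simp at hm
        · omega⟩
      obtain ⟨b, hb, h⟩ := h n
      rw [mul_comm, hkey, h, ← mul_assoc, ← map_natCast (algebraMap ℚ K), ← map_mul, one_div,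
        inv_mul_cancel₀ (by exact_mod_cast (Nat.mul_pos (Nat.succ_pos n) hppos).ne' :
          (((n + 1) * p : ℕ) : ℚ) ≠ 0), map_one, one_mul]
      exact hb
    · obtain ⟨k, rfl⟩ : ∃ k, m = k + 1 := ⟨m - 1, (Nat.sub_add_cancel hm).symm⟩
      rw [map_sub, coeff_smul, coeff_expand_of_not_dvd p hp0 _ hpm, smul_zero, sub_zero, ha]
      exact mul_mem (hA _ hpm) (hc k)

end FunctionalEquation

end Literature.RingTheory.FormalGroups
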